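import Summits.QuantumAdvantage.QuantumAdvantage.Theorems.LinnikCubicClassGroupsDegreeOnePrimesEscapeClassPNTDHTheta
import Summits.QuantumAdvantage.QuantumAdvantage.Theorems.LinnikCubicClassGroupsDegreeOnePrimesEscapeClassPNTFamilyDensity
import Summits.QuantumAdvantage.QuantumAdvantage.Theorems.LinnikCubicClassGroupsDegreeOnePrimesEscapeResidueAllFields
import HarnessLib

/-!
# The class prime number theorem with the Deuring–Heilbronn phenomenon, V: the Linnik deduction

Topic `Summits/QuantumAdvantage/QuantumAdvantage/Theorems`, cell B2b-1 (linnik-cubic), PART A (gen 4);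
helper toward the crux `DegreeOnePrimesEscape` (stmt-QuantumAdvantage-11543) of route
`LinnikCubicClassGroups`.  HONEST FRAMING: the value of this file is a THEOREM (kernel-checked,
GRH-free) — NOT summit progress (the route still rests on the hypothesis-type target
`PureCubicClassNumberHard`).

Linnik's three principles for the family `{ζ_K} ∪ {L(s,χ)}_{χ ∈ Ĉl_K}` of a number field `K` of degree
`n > 1` — the log-free zero-density estimate (`fam_density_local`, PART A seats 1–3), the zero-free
region with at most one exceptional zero (`exists_exceptionalZero_const`), and the Deuring–Heilbronn
phenomenon (hypothesis `hDH`: the statement of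
`Literature.NumberTheory.LFunctions.NumberField.deuringHeilbronn` verbatim, A-g3's programme) — give,
with the residue bound `κ_K ≥ Q^{−A(n)}` (`Residue.residueLowerBound_all`) and Stark's effective repulsion:

* `sub_mul_rpow_div_ge` — the main term: `x − r x^{β}/β ≥ (x/4)·min(1, (1 − β) log x)` for `|r| ≤ 1`,
  `3/4 ≤ β < 1`, `log x ≥ 16`;
* `thetaClass_relative_of_zeroRepulsion` — **the class prime number theorem with RELATIVE error in the
  Linnik range** (Thorner–Zaman's Theorem 1.4 for the Hilbert class field, `θ`-form): for every `ε > 0`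
  and `x ≥ Q^{a₂(n,ε)}`, EITHER `|θ_C(x) − x/h_K| ≤ ε x/h_K` for all `C`, OR
  `|θ_C(x) − M_C(x)/h_K| ≤ ε M_C(x)/h_K` with `M_C(x) = x − χ₁(C) x^{β₁}/β₁ > 0`;
* `exists_prime_mem_class_absNorm_le_of_zeroRepulsion` — **Linnik's theorem for ideal classes in EVERY
  degree**: there is `L = L(n) > 0` such that every ideal class of every number field of degree `n`
  contains a prime ideal of norm `≤ Q^{L}`, `Q = |d_K|·nⁿ` [Weiss1983, Thm. 5.2 for `H_K/K`; Fogels].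

Both are conditional here ONLY on `hDH`; the unconditional versions (import of the landed Literature
theorem) are in `…LeastPrimeIdeal.lean`.

References: J. Thorner, A. Zaman, Algebra Number Theory 13 (2019), Thm. 1.4 [ThornerZaman2019];
A. Weiss, *The least prime ideal*, J. reine angew. Math. 338 (1983) 56–94, Thm. 5.2 [Weiss1983];
E. Bombieri, Astérisque 18, §6 [Bombieri1974].
-/

noncomputable section

open Complex Real MeasureTheory Set Filter Topology
open scoped NumberField nonZeroDivisors

namespace Summit.QuantumAdvantage.QuantumAdvantage.Theorems.DegreeOnePrimesEscape

open Literature.NumberTheory.LFunctions Literature.NumberTheory.LFunctions.NumberField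
  Literature.NumberTheory.LFunctions.EntireEF Literature.NumberTheory.LFunctions.TZWeight
  Literature.NumberTheory.LFunctions.AbelianDensity

/-! ### The main term with the exceptional zero -/

/-- **The main term `x − r x^β/β` is at least `(x/4)·min(1, (1 − β) log x)`** for `|r| ≤ 1`,
`3/4 ≤ β < 1` and `log x ≥ 16` (`x^β = x e^{−t}`, `t = (1 − β) log x`, `e^{−t} ≤ 1/(1 + t)`). [folklore] -/
theorem sub_mul_rpow_div_ge {x β r : ℝ} (hx : 1 < x) (hL : 16 ≤ Real.log x) (hβ : 3 / 4 ≤ β)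
    (hβ1 : β < 1) (hr : |r| ≤ 1) :
    x / 4 * min 1 ((1 - β) * Real.log x) ≤ x - r * x ^ β / β := by
  have hx0 : 0 < x := by linarith
  have hβ0 : 0 < β := by linarith
  set L : ℝ := Real.log x with hL'
  set t : ℝ := (1 - β) * L with ht
  have hδ0 : 0 < 1 - β := by linarith
  have ht0 : 0 < t := mul_pos hδ0 (by linarith)
  -- `x^β = x e^{-t}`
  set e : ℝ := Real.exp (-t) with he'
  have he0 : 0 < e := Real.exp_pos _
  have hxβ : x ^ β = x * e := by
    rw [he', Real.rpow_def_of_pos hx0, ← hL', show L * β = L + -t by rw [ht]; ring, Real.exp_add,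
      Real.exp_log hx0]
  -- `e ≤ 1/(1+t)`, i.e. `e (1 + t) ≤ 1`
  have het : e * (1 + t) ≤ 1 := by
    have h1 : 1 + t ≤ Real.exp t := by linarith [Real.add_one_le_exp t]
    have h2 : e * Real.exp t = 1 := by rw [he', ← Real.exp_add]; simp
    nlinarith [mul_le_mul_of_nonneg_left h1 he0.le]
  -- `r x^β/β ≤ x^β/β`
  have hr1 : r ≤ 1 := (abs_le.1 hr).2
  have h1 : r * x ^ β / β ≤ x ^ β / β := by
    refine div_le_div_of_nonneg_right ?_ hβ0.le
    have := Real.rpow_pos_of_pos hx0 β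
    nlinarith
  -- `1 ≤ (1 + t) β (1 − m/4)`, `m = min 1 t`
  set m : ℝ := min 1 t with hm
  have hkey : 1 ≤ (1 + t) * β * (1 - m / 4) := by
    rcases le_or_gt 1 t with h1t | ht1
    · rw [hm, min_eq_left h1t]
      nlinarith
    · rw [hm, min_eq_right ht1.le]
      -- `β ≥ 1 − t/16` since `1 − β = t/L ≤ t/16`
      have hβt : 1 - t / 16 ≤ β := by
        have : (1 - β) * 16 ≤ (1 - β) * L := mul_le_mul_of_nonneg_left hL hδ0.le
        rw [← ht] at this; linarith
      have htt : t ^ 2 ≤ t := by nlinarith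
      have hA : 1 + t / 2 ≤ (1 + t) * (1 - t / 4) := by nlinarith
      have hB : 1 ≤ (1 + t / 2) * (1 - t / 16) := by nlinarith
      have hC : (1 + t / 2) * (1 - t / 16) ≤ (1 + t) * (1 - t / 4) * (1 - t / 16) :=
        mul_le_mul_of_nonneg_right hA (by linarith)
      have hD : (1 + t) * (1 - t / 4) * (1 - t / 16) ≤ (1 + t) * (1 - t / 4) * β :=
        mul_le_mul_of_nonneg_left hβt (by nlinarith)
      nlinarith
  -- hence `e ≤ β (1 − m/4)` and `x − x e/β ≥ x m/4`
  have hm1 : m ≤ 1 := min_le_left _ _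
  have hm0 : 0 < m := lt_min one_pos ht0
  have heβ : e ≤ β * (1 - m / 4) := by
    have h0 : 0 ≤ β * (1 - m / 4) := by nlinarith
    -- `e (1+t) ≤ 1 ≤ (1+t) β (1 − m/4)` and `1 + t > 0`
    have := het.trans hkey
    nlinarith
  have hfin : x / 4 * m ≤ x - x ^ β / β := by
    rw [hxβ]
    have h2 : x * e / β ≤ x * (1 - m / 4) := by
      rw [div_le_iff₀ hβ0]
      have := mul_le_mul_of_nonneg_left heβ hx0.le
      linarith
    linarith
  exact hfin.trans (by linarith)

/-! ### From `θ_C(x) > 0` to a prime ideal -/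

/-- If `θ_C(x) > 0` then the class `C` contains a prime ideal of norm `≤ x`. [folklore] -/
theorem exists_prime_of_chebyshevThetaIdealClass_pos {K : Type} [Field K] [NumberField K]
    (C : ClassGroup (𝓞 K)) {x : ℝ} (hx : 0 ≤ x) (hθ : 0 < chebyshevThetaIdealClass K C x) :
    ∃ (P : Ideal (𝓞 K)) (hP : P ∈ (Ideal (𝓞 K))⁰), P.IsPrime ∧ ClassGroup.mk0 ⟨P, hP⟩ = C ∧
      (Ideal.absNorm P : ℝ) ≤ x := by
  classical
  rw [chebyshevThetaIdealClass_eq_sum_primeIdealsInClassLE K C hx] at hθ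
  obtain ⟨P, hPmem, -⟩ := Finset.exists_ne_zero_of_sum_ne_zero hθ.ne'
  rw [Set.Finite.mem_toFinset] at hPmem
  obtain ⟨hprime, hle, hP0, hC⟩ := hPmem
  exact ⟨P, hP0, hprime, hC, hle⟩

/-! ### The class prime number theorem with relative error, and Linnik's theorem for ideal classes -/

set_option maxHeartbeats 800000 in
/-- **The class prime number theorem with RELATIVE error in the Linnik range, given Deuring–Heilbronn**
(`θ`-form of Thorner–Zaman's Theorem 1.4 for the Hilbert class field): for `n > 1` and `ε > 0` there are
`a₂ ≥ 1` and `0 < c ≤ 1/(8(n²+1))` such that for every number field `K` of degree `n`, EITHER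
`|θ_C(x) − x/h_K| ≤ ε x/h_K` for all `x ≥ Q^{a₂}` and all classes `C`, OR there is a real class group
character `χ₁` with a real zero `β₁ ∈ (1 − c/(log|d_K| + log 4), 1)` of `L(s, χ₁)` such that, with
`M_C(x) = x − χ₁(C) x^{β₁}/β₁`, `|θ_C(x) − M_C(x)/h_K| ≤ ε M_C(x)/h_K` for all `x ≥ Q^{a₂}`, all `C`.
[cite: ThornerZaman2019, Theorem 1.4] [cite: Weiss1983, Theorem 5.2] -/
theorem thetaClass_relative_of_zeroRepulsion
    (hDH : ∃ C : ℝ, 0 < C ∧ ∀ (K : Type) [Field K] [NumberField K] (χ₁ : ClassGroup (𝓞 K) →* ℂˣ),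
      χ₁ * χ₁ = 1 → ∀ β₁ : ℝ, 0 < β₁ → β₁ < 1 → classGroupLFunction K χ₁ β₁ = 0 →
      ∀ (χ : ClassGroup (𝓞 K) →* ℂˣ) (ρ : ℂ), classGroupLFunction K χ ρ = 0 → 1 / 2 ≤ ρ.re → ρ ≠ 1 →
        ρ ≠ β₁ →
        Real.log (1 / (C * (Real.log ((NumberField.discr K).natAbs : ℝ) +
            Module.finrank ℚ K * (Real.log (|ρ.im| + 2) + 1)) * (1 - β₁))) /
          (C * (Real.log ((NumberField.discr K).natAbs : ℝ) +
            Module.finrank ℚ K * (Real.log (|ρ.im| + 2) + 1))) ≤ 1 - ρ.re)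
    (n : ℕ) (hn : 1 < n) {ε : ℝ} (hε : 0 < ε) :
    ∃ a₂ c : ℝ, 1 ≤ a₂ ∧ 0 < c ∧ c ≤ 1 / (8 * ((n : ℝ) ^ 2 + 1)) ∧
    ∀ (K : Type) [Field K] [NumberField K], Module.finrank ℚ K = n →
      (∀ x : ℝ, ThornerZaman.condQn K ^ a₂ ≤ x → ∀ C : ClassGroup (𝓞 K),
          |chebyshevThetaIdealClass K C x - x / NumberField.classNumber K| ≤
            ε * x / NumberField.classNumber K) ∨
      ∃ (χ₁ : ClassGroup (𝓞 K) →* ℂˣ) (β₁ : ℝ), χ₁ * χ₁ = 1 ∧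
          1 - c / (Real.log ((NumberField.discr K).natAbs : ℝ) + Real.log 4) < β₁ ∧ β₁ < 1 ∧
          classGroupLFunction K χ₁ β₁ = 0 ∧
          ∀ x : ℝ, ThornerZaman.condQn K ^ a₂ ≤ x → ∀ C : ClassGroup (𝓞 K),
            0 < x - ((χ₁ C : ℂ)).re * x ^ β₁ / β₁ ∧
            |chebyshevThetaIdealClass K C x -
                (x - ((χ₁ C : ℂ)).re * x ^ β₁ / β₁) / NumberField.classNumber K| ≤
              ε * (x - ((χ₁ C : ℂ)).re * x ^ β₁ / β₁) / NumberField.classNumber K := by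
  classical
  obtain ⟨A, -, hA⟩ := Residue.residueLowerBound_all n
  obtain ⟨b, D, hb, hD, hdens⟩ := fam_density_local n hn A
  have ha : (1 : ℝ) ≤ max A 4 := le_trans (by norm_num) (le_max_right _ _)
  have hε4 : 0 < ε / 4 := by positivity
  obtain ⟨a₂, c, ha₂1, hc, hcn, hθ⟩ := thetaClass_dichotomy_dh n hn hb hD ha hε4 hDH
  have hn2 : (2 : ℝ) ≤ n := by exact_mod_cast hn
  refine ⟨max a₂ 16, c, le_trans ha₂1 (le_max_left _ _), hc, hcn, fun K _ _ hKn ↦ ?_⟩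
  have hK : 1 < Module.finrank ℚ K := by rw [hKn]; exact hn
  set Q : ℝ := ThornerZaman.condQn K with hQ
  have hQ12 : (12 : ℝ) ≤ Q := ThornerZaman.twelve_le_condQn (K := K) hK
  have hQ1 : (1 : ℝ) < Q := by linarith
  have hlogQ : 2 ≤ Real.log Q := two_lt_log_twelve.le.trans (Real.log_le_log (by norm_num) hQ12)
  set h : ℝ := (NumberField.classNumber K : ℝ) with hh
  have hh1 : 1 ≤ h := by rw [hh]; exact_mod_cast one_le_classNumber (K := K)
  have hh0 : 0 < h := by linarith
  -- sizes at `x ≥ Q^{max a₂ 16}`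
  have hsz : ∀ x : ℝ, Q ^ max a₂ 16 ≤ x → Q ^ a₂ ≤ x ∧ 1 < x ∧ 16 ≤ Real.log x := by
    intro x hx
    have hxa₂ : Q ^ a₂ ≤ x := le_trans (Real.rpow_le_rpow_of_exponent_le hQ1.le (le_max_left _ _)) hx
    have hxQ : Q ≤ x := by
      have : Q ^ (1 : ℝ) ≤ Q ^ a₂ := Real.rpow_le_rpow_of_exponent_le hQ1.le ha₂1
      rw [Real.rpow_one] at this; linarith
    have hLQ : max a₂ 16 * Real.log Q ≤ Real.log x := by
      have := Real.log_le_log (by positivity) hx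
      rwa [Real.log_rpow (by linarith)] at this
    have h16 : (16 : ℝ) ≤ max a₂ 16 := le_max_right _ _
    exact ⟨hxa₂, by linarith, by nlinarith⟩
  rcases hθ K hKn (hdens K hKn (hA K hKn)) with hgood | ⟨χ₁, β₁, hreal, hβlow, hβ1, hLz, hexc⟩
  · left
    intro x hx C
    obtain ⟨hxa₂, hx1, -⟩ := hsz x hx
    have := hgood x hxa₂ C
    have hx0 : 0 < x := by linarith
    have : ε / 4 * x / h ≤ ε * x / h := by
      rw [div_le_div_iff_of_pos_right hh0]; nlinarith
    linarith
  · right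
    -- `β₁ ≥ 3/4`
    have hβ34 : 3 / 4 ≤ β₁ := by
      have hlog4 : 1 < Real.log 4 := by
        rw [show (4:ℝ) = 2 ^ 2 by norm_num, Real.log_pow]; have := Real.log_two_gt_d9; push_cast; linarith
      have hlogd : 0 ≤ Real.log ((NumberField.discr K).natAbs : ℝ) := Real.log_natCast_nonneg _
      have hc4 : c ≤ 1 / 4 :=
        hcn.trans (by rw [div_le_div_iff_of_pos_left one_pos (by positivity) (by norm_num)]; nlinarith)
      have : c / (Real.log ((NumberField.discr K).natAbs : ℝ) + Real.log 4) ≤ 1 / 4 := by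
        rw [div_le_iff₀ (by linarith)]; nlinarith
      linarith
    refine ⟨χ₁, β₁, hreal, hβlow, hβ1, hLz, fun x hx C ↦ ?_⟩
    obtain ⟨hxa₂, hx1, hL16⟩ := hsz x hx
    have hx0 : 0 < x := by linarith
    have hb := hexc x hxa₂ C
    have hr := abs_re_classGroupChar_apply_le hreal C
    have hM := sub_mul_rpow_div_ge hx1 hL16 hβ34 hβ1 hr
    have hm0 : 0 < min 1 ((1 - β₁) * Real.log x) := lt_min one_pos (mul_pos (by linarith) (by linarith))
    have hM0 : 0 < x - ((χ₁ C : ℂ)).re * x ^ β₁ / β₁ := lt_of_lt_of_le (by positivity) hM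
    refine ⟨hM0, hb.trans ?_⟩
    rw [div_le_div_iff_of_pos_right hh0]
    nlinarith

/-- **Linnik's theorem for ideal classes in every degree, given Deuring–Heilbronn**: for `n > 1` there is
`L > 0` such that every ideal class of every number field `K` of degree `n` contains a prime ideal of
norm `≤ Q^{L}`, `Q = |d_K|·nⁿ`.  GRH-free, Siegel-free; conditional only on the hypothesis `hDH` (the
statement of the Literature theorem `deuringHeilbronn`). [cite: Weiss1983, Theorem 5.2]
[cite: ThornerZaman2019, Theorem 1.4] -/
theorem exists_prime_mem_class_absNorm_le_of_zeroRepulsion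
    (hDH : ∃ C : ℝ, 0 < C ∧ ∀ (K : Type) [Field K] [NumberField K] (χ₁ : ClassGroup (𝓞 K) →* ℂˣ),
      χ₁ * χ₁ = 1 → ∀ β₁ : ℝ, 0 < β₁ → β₁ < 1 → classGroupLFunction K χ₁ β₁ = 0 →
      ∀ (χ : ClassGroup (𝓞 K) →* ℂˣ) (ρ : ℂ), classGroupLFunction K χ ρ = 0 → 1 / 2 ≤ ρ.re → ρ ≠ 1 →
        ρ ≠ β₁ →
        Real.log (1 / (C * (Real.log ((NumberField.discr K).natAbs : ℝ) +
            Module.finrank ℚ K * (Real.log (|ρ.im| + 2) + 1)) * (1 - β₁))) /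
          (C * (Real.log ((NumberField.discr K).natAbs : ℝ) +
            Module.finrank ℚ K * (Real.log (|ρ.im| + 2) + 1))) ≤ 1 - ρ.re)
    (n : ℕ) (hn : 1 < n) :
    ∃ L : ℝ, 0 < L ∧ ∀ (K : Type) [Field K] [NumberField K], Module.finrank ℚ K = n →
      ∀ C : ClassGroup (𝓞 K), ∃ (P : Ideal (𝓞 K)) (hP : P ∈ (Ideal (𝓞 K))⁰), P.IsPrime ∧
        ClassGroup.mk0 ⟨P, hP⟩ = C ∧ (Ideal.absNorm P : ℝ) ≤ ThornerZaman.condQn K ^ L := by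
  classical
  obtain ⟨a₂, c, ha₂1, -, -, hθ⟩ :=
    thetaClass_relative_of_zeroRepulsion hDH n hn (by norm_num : (0 : ℝ) < 1 / 2)
  refine ⟨a₂, by linarith, fun K _ _ hKn C ↦ ?_⟩
  have hK : 1 < Module.finrank ℚ K := by rw [hKn]; exact hn
  set Q : ℝ := ThornerZaman.condQn K with hQ
  have hQ12 : (12 : ℝ) ≤ Q := ThornerZaman.twelve_le_condQn (K := K) hK
  have hQ1 : (1 : ℝ) < Q := by linarith
  set x : ℝ := Q ^ a₂ with hx
  have hxQ : Q ≤ x := by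
    have := Real.rpow_le_rpow_of_exponent_le hQ1.le ha₂1
    rwa [Real.rpow_one] at this
  have hx0 : 0 < x := by linarith
  set h : ℝ := (NumberField.classNumber K : ℝ) with hh
  have hh1 : 1 ≤ h := by rw [hh]; exact_mod_cast one_le_classNumber (K := K)
  have hh0 : 0 < h := by linarith
  have hθpos : 0 < chebyshevThetaIdealClass K C x := by
    rcases hθ K hKn with hgood | ⟨χ₁, β₁, -, -, -, -, hexc⟩
    · have h1 := (abs_sub_le_iff.1 (hgood x le_rfl C)).2
      have h2 : 0 < x / h - 1 / 2 * x / h := by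
        rw [← sub_div]; exact div_pos (by linarith) hh0
      linarith
    · obtain ⟨hM0, hb⟩ := hexc x le_rfl C
      have h1 := (abs_sub_le_iff.1 hb).2
      set M : ℝ := x - ((χ₁ C : ℂ)).re * x ^ β₁ / β₁
      have h2 : 0 < M / h - 1 / 2 * M / h := by
        rw [← sub_div]; exact div_pos (by linarith) hh0
      linarith
  exact exists_prime_of_chebyshevThetaIdealClass_pos C hx0.le hθpos

end Summit.QuantumAdvantage.QuantumAdvantage.Theorems.DegreeOnePrimesEscape

end
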